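import Literature.NumberTheory.BeurlingPrimes.DMVConvPow
import Mathlib.MeasureTheory.Integral.Prod
import Mathlib.Analysis.SpecialFunctions.Integrals.Basic
import Mathlib.Analysis.Calculus.Deriv.Shift
import HarnessLib

/-!
# Integration by parts against the convolution powers `U_n`, without derivatives

Topic `Literature/NumberTheory/BeurlingPrimes`, grouping namespace `DMV` (Diamond–Montgomery–Vorhauer
2006, §4 and §9). Everything in this file is PROVED.

DMV obtain the prime number theorem with remainder for their template, Theorem 1 (iv)–(v), from the
explicit formula (§9). In this development the Chebyshev function of the template is treated in the
real variable: `∫₁ˣ log v dΠ_C(v) = (x − 1 − log x) − 2 ∑_k ∫₁ˣ log v · oscTerm_k(v) dv` and, after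
`v = e^{ℓ_k y}`, each term is `ℓ_k ∫₀^{T} f(e^y) · y e^{b y} cos(w y) dy` with `f(e^y) = ∑_n U_n(y)/n`
(`DMVMellinDensity.lean`), `b = ℓ_k β_k`, `w = ℓ_k γ_k`, `T = log x/ℓ_k`. The decay in `w` (one factor
`1/w = 1/(ℓ_k γ_k)` per integration by parts) is extracted here **without differentiating** the
piecewise-polynomial `U_n`: using only the recursion `U_{m+1}(s) = ∫₁² U_m(s − t) dt` and Fubini,

* `DMV.integral_convPow_succ_mul` — for `φ` continuous with primitive `Φ` (`Φ' = φ`), `m ≥ 1`, `T ≥ 0`: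
  `∫₀ᵀ U_{m+1}(s) φ(s) ds = ∫₀ᵀ U_m(r) (Φ(r + c_T(r)) − Φ(r + 1)) dr`, `c_T(r) = max 1 (min 2 (T − r))`;
* `DMV.integral_convPow_one_mul` — `∫₀ᵀ U_1 φ = Φ(c_T(0)) − Φ(1)`;
* `DMV.integral_convPow_succ_mul_eq_split` — for `T ≥ 2` the same identity split as
  `Φ(T) U_{m+1}(T) + ∫₀^{T−2} U_m(r) Φ(r+2) dr − ∫₀^{T−1} U_m(r) Φ(r+1) dr` (the boundary term of the
  integration by parts appears through `∫_{T−2}^{T−1} U_m = U_{m+1}(T)`);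
* `DMV.sum_abs_integral_convPow_mul_le` — **the weighted bound**: if `|Φ(y)| ≤ K (y + 2) e^{b y}` for
  `y ≥ 0` (`K ≥ 0`, `b > 0`), then for every `M` and `T ≥ 0`,
  `∑_{n<M} (1/(n+1)) |∫₀ᵀ U_{n+1}(s) φ(s) ds| ≤ 8 K e^{bT} (4 + 1/b)`
  (only `n + 1 ≥ (r + 2)/2` contribute at `r`, and `∑_n U_n ≤ 1`, `DMVConvPow.renewalSum_le_one`).

Also a Fubini lemma for bounded measurable integrands on rectangles (`DMV.intervalIntegral_swap_of_bdd`).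

## References
* [DiamondMontgomeryVorhauer2006] H. G. Diamond, H. L. Montgomery, U. M. A. Vorhauer, *Beurling primes
  with large oscillation*, Math. Ann. 334 (2006) 1–36, §4 (26) and §9 pp. 25–27 (read).
-/

noncomputable section

open MeasureTheory Set intervalIntegral Filter

namespace Literature.NumberTheory.BeurlingPrimes

namespace DMV

/-! ### Fubini on a rectangle, and integrability of bounded measurable functions -/

/-- Fubini for a measurable integrand bounded on the rectangle `(a,b] × (c,d]`. [folklore] -/
theorem intervalIntegral_swap_of_bdd {F : ℝ → ℝ → ℝ} (hF : Measurable (Function.uncurry F))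
    {a b c d : ℝ} (C : ℝ) (hC : ∀ x ∈ Ioc a b, ∀ y ∈ Ioc c d, |F x y| ≤ C) (hab : a ≤ b) (hcd : c ≤ d) :
    ∫ x in a..b, ∫ y in c..d, F x y = ∫ y in c..d, ∫ x in a..b, F x y := by
  refine intervalIntegral_intervalIntegral_swap ?_
  rw [uIoc_of_le hab, uIoc_of_le hcd]
  refine IntegrableOn.of_bound ?_ hF.aestronglyMeasurable C ?_
  · rw [Measure.volume_eq_prod, Measure.prod_prod]
    exact ENNReal.mul_lt_top measure_Ioc_lt_top measure_Ioc_lt_top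
  · refine (ae_restrict_iff' (measurableSet_Ioc.prod measurableSet_Ioc)).mpr (Eventually.of_forall ?_)
    rintro ⟨x, y⟩ ⟨hx, hy⟩
    rw [Real.norm_eq_abs]
    exact hC x hx y hy

/-- A measurable function with `|g| ≤ C` everywhere is interval integrable on every interval. [folklore] -/
theorem intervalIntegrable_of_abs_le {g : ℝ → ℝ} (hg : Measurable g) (C : ℝ) (hC : ∀ x, |g x| ≤ C)
    (a b : ℝ) : IntervalIntegrable g volume a b := by
  rw [intervalIntegrable_iff]
  refine IntegrableOn.of_bound ?_ hg.aestronglyMeasurable C (Eventually.of_forall fun x ↦ ?_)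
  · exact measure_Ioc_lt_top
  · rw [Real.norm_eq_abs]; exact hC x

/-! ### The clamp `c_T(r)` and the truncated shifted integrand -/

/-- `c_T(r) = max 1 (min 2 (T − r))`: the upper limit of `t ∈ [1,2]` subject to `r + t ≤ T`. [folklore] -/
def clampT (T r : ℝ) : ℝ := max 1 (min 2 (T - r))

/-- `1 ≤ c_T(r)`. [folklore] -/
theorem one_le_clampT (T r : ℝ) : 1 ≤ clampT T r := le_max_left _ _

/-- `c_T(r) ≤ 2`. [folklore] -/
theorem clampT_le_two (T r : ℝ) : clampT T r ≤ 2 :=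
  max_le one_le_two (min_le_left _ _)

/-- `c_T(r) = 2` when `T − r ≥ 2`. [folklore] -/
theorem clampT_of_two_le {T r : ℝ} (h : 2 ≤ T - r) : clampT T r = 2 := by
  unfold clampT
  rw [min_eq_left h, max_eq_right one_le_two]

/-- `c_T(r) = 1` when `T − r ≤ 1`. [folklore] -/
theorem clampT_of_le_one {T r : ℝ} (h : T - r ≤ 1) : clampT T r = 1 := by
  unfold clampT
  exact max_eq_left (le_trans (min_le_right _ _) h)

/-- `c_T(r) = T − r` when `1 ≤ T − r ≤ 2`. [folklore] -/
theorem clampT_of_mem {T r : ℝ} (h1 : 1 ≤ T - r) (h2 : T - r ≤ 2) : clampT T r = T - r := by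
  unfold clampT
  rw [min_eq_right h2, max_eq_right h1]

/-- `r + c_T(r) ≤ T` when `r ≤ T − 1`, and `r + c_T(r) ≤ r + 2`. [folklore] -/
theorem add_clampT_le {T r : ℝ} (h : 1 ≤ T - r) : r + clampT T r ≤ min (r + 2) T := by
  refine le_min (by linarith [clampT_le_two T r]) ?_
  unfold clampT
  rcases le_or_gt (T - r) 2 with h2 | h2
  · rw [min_eq_right h2, max_eq_right h]
    linarith
  · rw [min_eq_left h2.le, max_eq_right one_le_two]
    linarith

/-- The truncated shifted integrand `trunc T φ r t = φ(r + t)` if `r + t ≤ T`, else `0`. [folklore] -/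
def trunc (T : ℝ) (φ : ℝ → ℝ) (r t : ℝ) : ℝ := if r + t ≤ T then φ (r + t) else 0

/-- `trunc = φ(r + t)` when `r + t ≤ T`. [folklore] -/
theorem trunc_of_le {T : ℝ} {φ : ℝ → ℝ} {r t : ℝ} (h : r + t ≤ T) : trunc T φ r t = φ (r + t) := by
  simp [trunc, h]

/-- `trunc = 0` when `T < r + t`. [folklore] -/
theorem trunc_of_lt {T : ℝ} {φ : ℝ → ℝ} {r t : ℝ} (h : T < r + t) : trunc T φ r t = 0 := by
  simp [trunc, not_le.mpr h]

/-- Joint measurability of `(r, t) ↦ trunc T φ r t`. [folklore] -/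
theorem measurable_trunc (T : ℝ) {φ : ℝ → ℝ} (hφ : Measurable φ) :
    Measurable (fun p : ℝ × ℝ ↦ trunc T φ p.1 p.2) := by
  unfold trunc
  refine Measurable.ite ?_ (hφ.comp (measurable_fst.add measurable_snd)) measurable_const
  exact measurableSet_le (measurable_fst.add measurable_snd) measurable_const

/-! ### The inner `t`-integral by the fundamental theorem of calculus -/

/-- `∫₁ᶜ φ(r + t) dt = Φ(r + c) − Φ(r + 1)`. [folklore] -/
theorem integral_comp_add_eq_sub {φ Φ : ℝ → ℝ} (hφ : Continuous φ) (hΦ : ∀ x, HasDerivAt Φ (φ x) x)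
    (r c : ℝ) : ∫ t in (1 : ℝ)..c, φ (r + t) = Φ (r + c) - Φ (r + 1) := by
  refine intervalIntegral.integral_eq_sub_of_hasDerivAt (f := fun t ↦ Φ (r + t)) (fun t _ ↦ ?_) ?_
  · exact (hΦ (r + t)).comp_const_add r t
  · exact (hφ.comp (continuous_const.add continuous_id)).intervalIntegrable _ _

/-- `∫₁² trunc T φ r t dt = Φ(r + c_T(r)) − Φ(r + 1)`. [folklore] -/
theorem integral_trunc_eq {φ Φ : ℝ → ℝ} (hφ : Continuous φ) (hΦ : ∀ x, HasDerivAt Φ (φ x) x)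
    (T r : ℝ) : ∫ t in (1 : ℝ)..2, trunc T φ r t = Φ (r + clampT T r) - Φ (r + 1) := by
  rcases le_or_gt 2 (T - r) with h2 | h2
  · -- all of `[1,2]` survives
    rw [clampT_of_two_le h2, ← integral_comp_add_eq_sub hφ hΦ r 2]
    refine intervalIntegral.integral_congr fun t ht ↦ ?_
    rw [uIcc_of_le one_le_two] at ht
    exact trunc_of_le (by linarith [ht.2])
  rcases le_or_gt (T - r) 1 with h1 | h1
  · -- nothing survives (a.e. on `(1,2]`)
    rw [clampT_of_le_one h1, sub_self]
    rw [intervalIntegral.integral_congr_ae (g := fun _ ↦ (0 : ℝ)) (Eventually.of_forall fun t ht ↦ ?_)]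
    · simp
    · rw [uIoc_of_le one_le_two] at ht
      exact trunc_of_lt (by linarith [ht.1])
  · -- split at `c = T − r ∈ (1,2)`
    rw [clampT_of_mem h1.le h2.le]
    have hint : ∀ a b : ℝ, IntervalIntegrable (trunc T φ r) volume a b := by
      intro a b
      have hcont : Continuous fun t ↦ φ (r + t) := hφ.comp (continuous_const.add continuous_id)
      have h : IntervalIntegrable (fun t ↦ φ (r + t)) volume a b := hcont.intervalIntegrable a b
      rw [intervalIntegrable_iff] at h ⊢
      have heq : trunc T φ r = (Iic (T - r)).indicator fun t ↦ φ (r + t) := by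
        funext t
        by_cases h' : r + t ≤ T
        · rw [trunc_of_le h', indicator_of_mem (show t ∈ Iic (T - r) by rw [mem_Iic]; linarith)]
        · rw [trunc_of_lt (not_le.mp h'),
            indicator_of_notMem (show t ∉ Iic (T - r) by rw [mem_Iic]; push Not at h' ⊢; linarith)]
      rw [heq]
      exact h.indicator measurableSet_Iic
    rw [← intervalIntegral.integral_add_adjacent_intervals (hint 1 (T - r)) (hint (T - r) 2)]
    have hA : ∫ t in (1 : ℝ)..(T - r), trunc T φ r t = ∫ t in (1 : ℝ)..(T - r), φ (r + t) := by
      refine intervalIntegral.integral_congr fun t ht ↦ ?_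
      rw [uIcc_of_le h1.le] at ht
      exact trunc_of_le (by linarith [ht.2])
    have hB : ∫ t in (T - r)..(2 : ℝ), trunc T φ r t = ∫ _ in (T - r)..(2 : ℝ), (0 : ℝ) := by
      refine intervalIntegral.integral_congr_ae (Eventually.of_forall fun t ht ↦ ?_)
      rw [uIoc_of_le h2.le] at ht
      exact trunc_of_lt (by linarith [ht.1])
    rw [hA, hB, integral_comp_add_eq_sub hφ hΦ, intervalIntegral.integral_zero, add_zero]

/-! ### The Fubini identity -/

/-- A bound for a continuous function on `[0, T]`. [folklore] -/
theorem exists_abs_le_on_Icc {φ : ℝ → ℝ} (hφ : Continuous φ) (T : ℝ) :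
    ∃ B : ℝ, 0 ≤ B ∧ ∀ y ∈ Icc 0 T, |φ y| ≤ B := by
  obtain ⟨B, hB⟩ := (isCompact_Icc (a := (0 : ℝ)) (b := T)).exists_bound_of_continuousOn hφ.continuousOn
  refine ⟨max B 0, le_max_right _ _, fun y hy ↦ ?_⟩
  have := hB y hy
  rw [Real.norm_eq_abs] at this
  exact this.trans (le_max_left _ _)

/-- The `r`-integrand after translation: `G_t(r) = U_m(r) · trunc T φ r t` is measurable in `(t, r)`
and bounded by the bound of `φ` on `[0, T]` (for `t ≥ 0`). [folklore] -/
theorem abs_convPow_mul_trunc_le {φ : ℝ → ℝ} {T B : ℝ} (hB : ∀ y ∈ Icc 0 T, |φ y| ≤ B) (hB0 : 0 ≤ B)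
    (m : ℕ) {t : ℝ} (ht : 0 ≤ t) (r : ℝ) : |convPow m r * trunc T φ r t| ≤ B := by
  rcases lt_or_ge r 1 with hr | hr
  · rw [convPow_eq_zero_of_lt_one m hr, zero_mul, abs_zero]; exact hB0
  rw [abs_mul, abs_of_nonneg (convPow_nonneg m r)]
  by_cases h : r + t ≤ T
  · rw [trunc_of_le h]
    calc convPow m r * |φ (r + t)| ≤ 1 * B := by
          gcongr
          · exact convPow_le_one m r
          · exact hB _ ⟨by linarith, h⟩
      _ = B := one_mul B
  · rw [trunc_of_lt (not_le.mp h), abs_zero, mul_zero]; exact hB0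

/-- For `t ≥ 0` and `T ≥ 0`: `∫₀ᵀ U_m(s − t) φ(s) ds = ∫₀ᵀ U_m(r) trunc T φ r t dr` (translate by `t`,
drop `r ≤ 0` where `U_m = 0`, and cut at `r = T − t`). [folklore] -/
theorem integral_convPow_sub_mul_eq {φ : ℝ → ℝ} (hφ : Continuous φ) (m : ℕ) {T t : ℝ} (hT : 0 ≤ T)
    (ht : 0 ≤ t) :
    ∫ s in (0 : ℝ)..T, convPow m (s - t) * φ s = ∫ r in (0 : ℝ)..T, convPow m r * trunc T φ r t := by
  obtain ⟨B, hB0, hB⟩ := exists_abs_le_on_Icc hφ T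
  have hGm : Measurable fun r ↦ convPow m r * trunc T φ r t := by
    have h2 := measurable_trunc T hφ.measurable
    exact (measurable_convPow m).mul (h2.comp (measurable_id.prodMk measurable_const))
  have hGint : ∀ a b : ℝ, IntervalIntegrable (fun r ↦ convPow m r * trunc T φ r t) volume a b :=
    intervalIntegrable_of_abs_le hGm B (fun r ↦ abs_convPow_mul_trunc_le hB hB0 m ht r)
  -- translate
  have h1 : ∫ s in (0 : ℝ)..T, convPow m (s - t) * φ s = ∫ r in (0 - t)..(T - t), convPow m r * φ (r + t) := by
    rw [← intervalIntegral.integral_comp_sub_right (fun r ↦ convPow m r * φ (r + t)) t]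
    refine intervalIntegral.integral_congr fun s _ ↦ ?_
    simp only [sub_add_cancel]
  -- replace by the truncated integrand on `[−t, T − t]`
  have h2 : ∫ r in (0 - t)..(T - t), convPow m r * φ (r + t) =
      ∫ r in (0 - t)..(T - t), convPow m r * trunc T φ r t := by
    refine intervalIntegral.integral_congr fun r hr ↦ ?_
    rw [uIcc_of_le (by linarith)] at hr
    show convPow m r * φ (r + t) = convPow m r * trunc T φ r t
    rw [trunc_of_le (by linarith [hr.2])]
  -- `∫_{−t}^{0} = 0`
  have h3 : ∫ r in (0 - t)..(0 : ℝ), convPow m r * trunc T φ r t = 0 := by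
    rw [intervalIntegral.integral_congr (g := fun _ ↦ (0 : ℝ)) fun r hr ↦ ?_]
    · simp
    · rw [uIcc_of_le (by linarith)] at hr
      show convPow m r * trunc T φ r t = 0
      rw [convPow_eq_zero_of_lt_one m (by linarith [hr.2]), zero_mul]
  -- `∫_{T−t}^{T} = 0`
  have h4 : ∫ r in (T - t)..T, convPow m r * trunc T φ r t = 0 := by
    rw [intervalIntegral.integral_congr_ae (g := fun _ ↦ (0 : ℝ)) (Eventually.of_forall fun r hr ↦ ?_)]
    · simp
    · rw [uIoc_of_le (by linarith)] at hr
      show convPow m r * trunc T φ r t = 0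
      rw [trunc_of_lt (by linarith [hr.1]), mul_zero]
  have h5 := intervalIntegral.integral_add_adjacent_intervals (hGint (0 - t) 0) (hGint 0 (T - t))
  have h6 := intervalIntegral.integral_add_adjacent_intervals (hGint 0 (T - t)) (hGint (T - t) T)
  rw [h1, h2, ← h5, h3, zero_add, ← h6, h4, add_zero]

/-- **Integration by parts against `U_{m+1}` via Fubini** (`m ≥ 1`, `T ≥ 0`): for `φ` continuous with
primitive `Φ`, `∫₀ᵀ U_{m+1}(s) φ(s) ds = ∫₀ᵀ U_m(r) (Φ(r + c_T(r)) − Φ(r + 1)) dr`. [folklore] -/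
theorem integral_convPow_succ_mul {φ Φ : ℝ → ℝ} (hφ : Continuous φ) (hΦ : ∀ x, HasDerivAt Φ (φ x) x)
    {m : ℕ} (hm : 1 ≤ m) {T : ℝ} (hT : 0 ≤ T) :
    ∫ s in (0 : ℝ)..T, convPow (m + 1) s * φ s =
      ∫ r in (0 : ℝ)..T, convPow m r * (Φ (r + clampT T r) - Φ (r + 1)) := by
  obtain ⟨B, hB0, hB⟩ := exists_abs_le_on_Icc hφ T
  -- Step 1: recursion, and the constant `φ s` inside the `t`-integral
  have h1 : ∫ s in (0 : ℝ)..T, convPow (m + 1) s * φ s =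
      ∫ s in (0 : ℝ)..T, ∫ t in (1 : ℝ)..2, convPow m (s - t) * φ s := by
    refine intervalIntegral.integral_congr fun s _ ↦ ?_
    simp only [convPow_succ hm, intervalIntegral.integral_mul_const]
  -- Step 2: swap
  have h2 : ∫ s in (0 : ℝ)..T, ∫ t in (1 : ℝ)..2, convPow m (s - t) * φ s =
      ∫ t in (1 : ℝ)..2, ∫ s in (0 : ℝ)..T, convPow m (s - t) * φ s := by
    refine intervalIntegral_swap_of_bdd (F := fun s t ↦ convPow m (s - t) * φ s) ?_ B ?_ hT one_le_two
    · exact ((measurable_convPow m).comp (measurable_fst.sub measurable_snd)).mul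
        (hφ.measurable.comp measurable_fst)
    · intro s hs t _
      rw [abs_mul, abs_of_nonneg (convPow_nonneg _ _)]
      calc convPow m (s - t) * |φ s| ≤ 1 * B := by
            gcongr
            · exact convPow_le_one _ _
            · exact hB s ⟨hs.1.le, hs.2⟩
        _ = B := one_mul B
  -- Step 3: translate/truncate in `s`, for each `t ∈ [1,2]`
  have h3 : ∫ t in (1 : ℝ)..2, ∫ s in (0 : ℝ)..T, convPow m (s - t) * φ s =
      ∫ t in (1 : ℝ)..2, ∫ r in (0 : ℝ)..T, convPow m r * trunc T φ r t := by
    refine intervalIntegral.integral_congr fun t ht ↦ ?_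
    rw [uIcc_of_le one_le_two] at ht
    exact integral_convPow_sub_mul_eq hφ m hT (by linarith [ht.1])
  -- Step 4: swap back
  have h4 : ∫ t in (1 : ℝ)..2, ∫ r in (0 : ℝ)..T, convPow m r * trunc T φ r t =
      ∫ r in (0 : ℝ)..T, ∫ t in (1 : ℝ)..2, convPow m r * trunc T φ r t := by
    refine intervalIntegral_swap_of_bdd (F := fun t r ↦ convPow m r * trunc T φ r t) ?_ B ?_ one_le_two hT
    · have h := measurable_trunc T hφ.measurable
      exact ((measurable_convPow m).comp measurable_snd).mul (h.comp (measurable_snd.prodMk measurable_fst))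
    · intro t ht r _
      exact abs_convPow_mul_trunc_le hB hB0 m (by linarith [ht.1]) r
  -- Step 5: the inner integral
  have h5 : ∫ r in (0 : ℝ)..T, ∫ t in (1 : ℝ)..2, convPow m r * trunc T φ r t =
      ∫ r in (0 : ℝ)..T, convPow m r * (Φ (r + clampT T r) - Φ (r + 1)) := by
    refine intervalIntegral.integral_congr fun r _ ↦ ?_
    simp only [intervalIntegral.integral_const_mul, integral_trunc_eq hφ hΦ T r]
  rw [h1, h2, h3, h4, h5]

/-- **The first term**: `∫₀ᵀ U_1(s) φ(s) ds = Φ(c_T(0)) − Φ(1)` for `T ≥ 0`. [folklore] -/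
theorem integral_convPow_one_mul {φ Φ : ℝ → ℝ} (hφ : Continuous φ) (hΦ : ∀ x, HasDerivAt Φ (φ x) x)
    {T : ℝ} (hT : 0 ≤ T) :
    ∫ s in (0 : ℝ)..T, convPow 1 s * φ s = Φ (clampT T 0) - Φ 1 := by
  have hint : ∀ a b : ℝ, IntervalIntegrable (fun s ↦ convPow 1 s * φ s) volume a b := fun a b ↦
    (intervalIntegrable_of_abs_le (measurable_convPow 1) 1
      (fun s ↦ by rw [abs_of_nonneg (convPow_nonneg 1 s)]; exact convPow_le_one 1 s) a b).mul_continuousOn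
      hφ.continuousOn
  rcases lt_or_ge T 1 with hT1 | hT1
  · -- nothing: `U_1 = 0` on `[0, T]`
    rw [clampT_of_le_one (by linarith), sub_self]
    rw [intervalIntegral.integral_congr (g := fun _ ↦ (0 : ℝ)) fun s hs ↦ ?_]
    · simp
    · rw [uIcc_of_le hT] at hs
      simp only
      rw [convPow_eq_zero_of_lt_one 1 (by linarith [hs.2]), zero_mul]
  -- `T ≥ 1`: `∫₀¹ = 0` (a.e.), then `[1, min 2 T]`
  have h01 : ∫ s in (0 : ℝ)..1, convPow 1 s * φ s = 0 := by
    rw [intervalIntegral.integral_of_le zero_le_one, setIntegral_congr_set (Ioo_ae_eq_Ioc (a := (0:ℝ)) (b := 1)).symm,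
      setIntegral_congr_fun measurableSet_Ioo (g := fun _ ↦ (0 : ℝ)) fun s hs ↦ ?_]
    · simp
    · simp only
      rw [convPow_eq_zero_of_lt_one 1 hs.2, zero_mul]
  rw [← intervalIntegral.integral_add_adjacent_intervals (hint 0 1) (hint 1 T), h01, zero_add]
  rcases le_or_gt T 2 with hT2 | hT2
  · rw [show clampT T 0 = T by rw [clampT_of_mem (by linarith) (by linarith)]; ring]
    have hA : ∫ s in (1 : ℝ)..T, convPow 1 s * φ s = ∫ s in (1 : ℝ)..T, φ (0 + s) := by
      refine intervalIntegral.integral_congr fun s hs ↦ ?_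
      rw [uIcc_of_le hT1] at hs
      show convPow 1 s * φ s = φ (0 + s)
      rw [convPow_one_of_mem ⟨hs.1, hs.2.trans hT2⟩, one_mul, zero_add]
    rw [hA, integral_comp_add_eq_sub hφ hΦ 0 T, zero_add, zero_add]
  · rw [clampT_of_two_le (by linarith)]
    rw [← intervalIntegral.integral_add_adjacent_intervals (hint 1 2) (hint 2 T)]
    have hA : ∫ s in (1 : ℝ)..2, convPow 1 s * φ s = ∫ s in (1 : ℝ)..2, φ (0 + s) := by
      refine intervalIntegral.integral_congr fun s hs ↦ ?_
      rw [uIcc_of_le one_le_two] at hs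
      show convPow 1 s * φ s = φ (0 + s)
      rw [convPow_one_of_mem hs, one_mul, zero_add]
    have hB : ∫ s in (2 : ℝ)..T, convPow 1 s * φ s = 0 := by
      rw [intervalIntegral.integral_congr_ae (g := fun _ ↦ (0 : ℝ)) (Eventually.of_forall fun s hs ↦ ?_)]
      · simp
      · rw [uIoc_of_le hT2.le] at hs
        show convPow 1 s * φ s = 0
        rw [convPow_one_of_not_mem (fun h ↦ by linarith [h.2, hs.1]), zero_mul]
    rw [hA, hB, add_zero, integral_comp_add_eq_sub hφ hΦ 0 2, zero_add, zero_add]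

/-- **Split form** (`m ≥ 1`, `T ≥ 2`):
`∫₀ᵀ U_{m+1} φ = Φ(T) U_{m+1}(T) + ∫₀^{T−2} U_m(r) Φ(r+2) dr − ∫₀^{T−1} U_m(r) Φ(r+1) dr`. [folklore] -/
theorem integral_convPow_succ_mul_eq_split {φ Φ : ℝ → ℝ} (hφ : Continuous φ)
    (hΦ : ∀ x, HasDerivAt Φ (φ x) x) {m : ℕ} (hm : 1 ≤ m) {T : ℝ} (hT : 2 ≤ T) :
    ∫ s in (0 : ℝ)..T, convPow (m + 1) s * φ s =
      Φ T * convPow (m + 1) T + (∫ r in (0 : ℝ)..(T - 2), convPow m r * Φ (r + 2))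
        - ∫ r in (0 : ℝ)..(T - 1), convPow m r * Φ (r + 1) := by
  have hΦc : Continuous Φ := continuous_iff_continuousAt.mpr fun x ↦ (hΦ x).continuousAt
  rw [integral_convPow_succ_mul hφ hΦ hm (by linarith)]
  have hint1 : ∀ a b : ℝ, IntervalIntegrable (fun r ↦ convPow m r * Φ (r + clampT T r)) volume a b := by
    intro a b
    refine (intervalIntegrable_of_abs_le (measurable_convPow m) 1
        (fun s ↦ by rw [abs_of_nonneg (convPow_nonneg m s)]; exact convPow_le_one m s) a b).mul_continuousOn ?_
    refine (hΦc.comp (continuous_id.add ?_)).continuousOn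
    unfold clampT
    fun_prop
  have hint2 : ∀ (c : ℝ) (a b : ℝ), IntervalIntegrable (fun r ↦ convPow m r * Φ (r + c)) volume a b := by
    intro c a b
    refine (intervalIntegrable_of_abs_le (measurable_convPow m) 1
        (fun s ↦ by rw [abs_of_nonneg (convPow_nonneg m s)]; exact convPow_le_one m s) a b).mul_continuousOn ?_
    exact (hΦc.comp (continuous_id.add continuous_const)).continuousOn
  have hsub : ∫ r in (0 : ℝ)..T, convPow m r * (Φ (r + clampT T r) - Φ (r + 1)) =
      (∫ r in (0 : ℝ)..T, convPow m r * Φ (r + clampT T r)) - ∫ r in (0 : ℝ)..T, convPow m r * Φ (r + 1) := by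
    rw [← intervalIntegral.integral_sub (hint1 0 T) (hint2 1 0 T)]
    refine intervalIntegral.integral_congr fun r _ ↦ ?_
    ring
  rw [hsub]
  -- first integral: three pieces
  have hP1 : ∫ r in (0 : ℝ)..(T - 2), convPow m r * Φ (r + clampT T r) =
      ∫ r in (0 : ℝ)..(T - 2), convPow m r * Φ (r + 2) := by
    refine intervalIntegral.integral_congr fun r hr ↦ ?_
    rw [uIcc_of_le (by linarith)] at hr
    show convPow m r * Φ (r + clampT T r) = convPow m r * Φ (r + 2)
    rw [clampT_of_two_le (by linarith [hr.2])]
  have hP2 : ∫ r in (T - 2)..(T - 1), convPow m r * Φ (r + clampT T r) =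
      ∫ r in (T - 2)..(T - 1), convPow m r * Φ T := by
    refine intervalIntegral.integral_congr fun r hr ↦ ?_
    rw [uIcc_of_le (by linarith)] at hr
    show convPow m r * Φ (r + clampT T r) = convPow m r * Φ T
    rw [clampT_of_mem (by linarith [hr.2]) (by linarith [hr.1])]
    ring_nf
  have hP3 : ∫ r in (T - 1)..T, convPow m r * Φ (r + clampT T r) =
      ∫ r in (T - 1)..T, convPow m r * Φ (r + 1) := by
    refine intervalIntegral.integral_congr fun r hr ↦ ?_
    rw [uIcc_of_le (by linarith)] at hr
    show convPow m r * Φ (r + clampT T r) = convPow m r * Φ (r + 1)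
    rw [clampT_of_le_one (by linarith [hr.1])]
  have hU : ∫ r in (T - 2)..(T - 1), convPow m r * Φ T = Φ T * convPow (m + 1) T := by
    rw [intervalIntegral.integral_mul_const, convPow_succ hm,
      intervalIntegral.integral_comp_sub_left (fun r ↦ convPow m r) T]
    ring_nf
  have hA := intervalIntegral.integral_add_adjacent_intervals (hint1 0 (T - 2)) (hint1 (T - 2) (T - 1))
  have hA' := intervalIntegral.integral_add_adjacent_intervals
    ((hint1 0 (T - 2)).trans (hint1 (T - 2) (T - 1))) (hint1 (T - 1) T)
  have hB := intervalIntegral.integral_add_adjacent_intervals (hint2 1 0 (T - 1)) (hint2 1 (T - 1) T)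
  rw [← hA', ← hA, ← hB, hP1, hP2, hP3, hU]
  ring

/-! ### The weighted bound -/

/-- `∫₀ᵀ e^{b min(r+2, T)} dr ≤ e^{bT} (2 + 1/b)` for `T ≥ 0`, `b > 0`. [folklore] -/
theorem integral_exp_min_le {b T : ℝ} (hb : 0 < b) (hT : 0 ≤ T) :
    ∫ r in (0 : ℝ)..T, Real.exp (b * min (r + 2) T) ≤ Real.exp (b * T) * (2 + 1 / b) := by
  have hcont : Continuous fun r : ℝ ↦ Real.exp (b * min (r + 2) T) := by fun_prop
  have hle : ∀ r, Real.exp (b * min (r + 2) T) ≤ Real.exp (b * T) := fun r ↦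
    Real.exp_le_exp.mpr (mul_le_mul_of_nonneg_left (min_le_right _ _) hb.le)
  have hE0 : 0 < Real.exp (b * T) := Real.exp_pos _
  rcases le_or_gt T 2 with hT2 | hT2
  · calc ∫ r in (0 : ℝ)..T, Real.exp (b * min (r + 2) T) ≤ ∫ _ in (0 : ℝ)..T, Real.exp (b * T) :=
          intervalIntegral.integral_mono_on hT (hcont.intervalIntegrable _ _) intervalIntegrable_const
            fun r _ ↦ hle r
      _ = T * Real.exp (b * T) := by simp
      _ ≤ Real.exp (b * T) * (2 + 1 / b) := by
          have : 0 < 1 / b := by positivity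
          nlinarith
  · rw [← intervalIntegral.integral_add_adjacent_intervals (b := T - 2) (hcont.intervalIntegrable _ _)
      (hcont.intervalIntegrable _ _)]
    have hA : ∫ r in (0 : ℝ)..(T - 2), Real.exp (b * min (r + 2) T) = ∫ r in (0 : ℝ)..(T - 2), Real.exp (b * r + 2 * b) := by
      refine intervalIntegral.integral_congr fun r hr ↦ ?_
      rw [uIcc_of_le (by linarith)] at hr
      show Real.exp (b * min (r + 2) T) = Real.exp (b * r + 2 * b)
      rw [min_eq_left (by linarith [hr.2])]
      ring_nf
    have hA' : ∫ r in (0 : ℝ)..(T - 2), Real.exp (b * r + 2 * b) ≤ Real.exp (b * T) / b := by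
      rw [intervalIntegral.integral_comp_mul_add (fun x ↦ Real.exp x) hb.ne' (2 * b), integral_exp]
      simp only [smul_eq_mul, mul_zero, zero_add]
      have h1 : b * (T - 2) + 2 * b = b * T := by ring
      rw [h1, inv_mul_eq_div]
      exact div_le_div_of_nonneg_right (by linarith [Real.exp_pos (2 * b)]) hb.le
    have hB : ∫ r in (T - 2)..T, Real.exp (b * min (r + 2) T) ≤ 2 * Real.exp (b * T) := by
      calc ∫ r in (T - 2)..T, Real.exp (b * min (r + 2) T) ≤ ∫ _ in (T - 2)..T, Real.exp (b * T) :=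
            intervalIntegral.integral_mono_on (by linarith) (hcont.intervalIntegrable _ _) intervalIntegrable_const
              fun r _ ↦ hle r
        _ = 2 * Real.exp (b * T) := by rw [intervalIntegral.integral_const, smul_eq_mul]; ring
    rw [hA]
    have : Real.exp (b * T) * (2 + 1 / b) = Real.exp (b * T) / b + 2 * Real.exp (b * T) := by
      field_simp; ring
    rw [this]
    exact add_le_add hA' hB

/-- The bracket bound: if `|Φ(y)| ≤ K (y+2) e^{by}` for `y ≥ 0` then, for `0 ≤ r ≤ T`,
`|Φ(r + c_T(r)) − Φ(r+1)| ≤ 2K (r + 4) e^{b min(r+2, T)}`. [folklore] -/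
theorem abs_bracket_le {Φ : ℝ → ℝ} {K b : ℝ} (hK : 0 ≤ K) (hb : 0 < b)
    (hΦb : ∀ y, 0 ≤ y → |Φ y| ≤ K * (y + 2) * Real.exp (b * y)) {T r : ℝ} (hr : 0 ≤ r) :
    |Φ (r + clampT T r) - Φ (r + 1)| ≤ 2 * K * (r + 4) * Real.exp (b * min (r + 2) T) := by
  rcases lt_or_ge (T - r) 1 with h1 | h1
  · rw [clampT_of_le_one h1.le, sub_self, abs_zero]; positivity
  have hc := add_clampT_le (T := T) h1
  have hy1 : 0 ≤ r + clampT T r := by linarith [one_le_clampT T r]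
  have hmin1 : r + 1 ≤ min (r + 2) T := le_min (by linarith) (by linarith)
  have e1 : Real.exp (b * (r + clampT T r)) ≤ Real.exp (b * min (r + 2) T) :=
    Real.exp_le_exp.mpr (mul_le_mul_of_nonneg_left hc hb.le)
  have e2 : Real.exp (b * (r + 1)) ≤ Real.exp (b * min (r + 2) T) :=
    Real.exp_le_exp.mpr (mul_le_mul_of_nonneg_left hmin1 hb.le)
  have hA := hΦb (r + clampT T r) hy1
  have hB := hΦb (r + 1) (by linarith)
  have hc2 : r + clampT T r + 2 ≤ r + 4 := by linarith [clampT_le_two T r]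
  have hA' : K * (r + clampT T r + 2) * Real.exp (b * (r + clampT T r)) ≤ K * (r + 4) * Real.exp (b * min (r + 2) T) :=
    mul_le_mul (mul_le_mul_of_nonneg_left hc2 hK) e1 (Real.exp_pos _).le (by positivity)
  have hB' : K * (r + 1 + 2) * Real.exp (b * (r + 1)) ≤ K * (r + 4) * Real.exp (b * min (r + 2) T) :=
    mul_le_mul (mul_le_mul_of_nonneg_left (by linarith) hK) e2 (Real.exp_pos _).le (by positivity)
  calc |Φ (r + clampT T r) - Φ (r + 1)| ≤ |Φ (r + clampT T r)| + |Φ (r + 1)| := abs_sub _ _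
    _ ≤ K * (r + 4) * Real.exp (b * min (r + 2) T) + K * (r + 4) * Real.exp (b * min (r + 2) T) :=
        add_le_add (hA.trans hA') (hB.trans hB')
    _ = 2 * K * (r + 4) * Real.exp (b * min (r + 2) T) := by ring

/-- Only `n + 1 ≥ (r+2)/2` contribute at `r`: `∑_{1 ≤ n < M} U_n(r)/(n+1) ≤ 2/(r + 2)` for `r ≥ 0`
(renewal bound). [folklore] -/
theorem sum_convPow_div_le {M : ℕ} {r : ℝ} (hr : 0 ≤ r) :
    ∑ n ∈ Finset.range M, convPow n r / (n + 1) ≤ 2 / (r + 2) := by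
  have hterm : ∀ n ∈ Finset.range M, convPow n r / (n + 1) ≤ 2 / (r + 2) * convPow n r := by
    intro n _
    have h0 := convPow_nonneg n r
    rcases n with _ | n
    · simp
    rcases lt_or_ge (2 * ((n + 1 : ℕ) : ℝ)) r with hlt | hge
    · rw [convPow_eq_zero_of_gt (n + 1) r le_add_self hlt]; simp
    · push_cast at hge ⊢
      rw [div_le_iff₀ (by positivity)]
      have : convPow (n + 1) r * (r + 2) ≤ 2 * convPow (n + 1) r * (n + 1 + 1) := by nlinarith
      calc convPow (n + 1) r = 2 / (r + 2) * convPow (n + 1) r * ((r + 2) / 2) := by field_simp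
        _ ≤ 2 / (r + 2) * convPow (n + 1) r * (n + 1 + 1) := by
            refine mul_le_mul_of_nonneg_left (by linarith) (mul_nonneg (by positivity) h0)
  refine (Finset.sum_le_sum hterm).trans ?_
  rw [← Finset.mul_sum]
  -- `∑_{n<M} U_n(r) ≤ renewalSum M r ≤ 1` (the `n = 0` term is `0`)
  have hsum : ∑ n ∈ Finset.range M, convPow n r ≤ 1 := by
    rcases M with _ | M
    · simp
    rw [Finset.sum_range_succ']
    simp only [convPow_zero, add_zero]
    exact renewalSum_le_one M r
  calc 2 / (r + 2) * ∑ n ∈ Finset.range M, convPow n r ≤ 2 / (r + 2) * 1 := by gcongr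
    _ = 2 / (r + 2) := mul_one _

/-- **The weighted bound.** If `φ` is continuous with primitive `Φ`, `|Φ(y)| ≤ K (y + 2) e^{by}` for
`y ≥ 0` (`K ≥ 0`, `b > 0`), then for all `M` and `T ≥ 0`:
`∑_{n<M} (1/(n+1)) |∫₀ᵀ U_{n+1}(s) φ(s) ds| ≤ 8K e^{bT} (4 + 1/b)`. [folklore] -/
theorem sum_abs_integral_convPow_mul_le {φ Φ : ℝ → ℝ} (hφ : Continuous φ)
    (hΦ : ∀ x, HasDerivAt Φ (φ x) x) {K b : ℝ} (hK : 0 ≤ K) (hb : 0 < b)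
    (hΦb : ∀ y, 0 ≤ y → |Φ y| ≤ K * (y + 2) * Real.exp (b * y)) (M : ℕ) {T : ℝ} (hT : 0 ≤ T) :
    ∑ n ∈ Finset.range M, 1 / ((n : ℝ) + 1) * |∫ s in (0 : ℝ)..T, convPow (n + 1) s * φ s| ≤
      8 * K * Real.exp (b * T) * (4 + 1 / b) := by
  have hE := Real.exp_pos (b * T)
  rcases M with _ | M
  · simp; positivity
  rw [Finset.sum_range_succ']
  -- the `n = 0` term
  have h0 : 1 / ((0 : ℕ) + 1 : ℝ) * |∫ s in (0 : ℝ)..T, convPow (0 + 1) s * φ s| ≤ 8 * K * Real.exp (b * T) := by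
    rw [Nat.cast_zero, zero_add, div_one, one_mul, zero_add, integral_convPow_one_mul hφ hΦ hT]
    have h := abs_bracket_le hK hb hΦb (T := T) (le_refl 0)
    rw [zero_add, zero_add, zero_add, zero_add] at h
    refine h.trans ?_
    have e1 : Real.exp (b * min 2 T) ≤ Real.exp (b * T) :=
      Real.exp_le_exp.mpr (mul_le_mul_of_nonneg_left (min_le_right _ _) hb.le)
    calc 2 * K * 4 * Real.exp (b * min 2 T) ≤ 2 * K * 4 * Real.exp (b * T) :=
          mul_le_mul_of_nonneg_left e1 (by positivity)
      _ = 8 * K * Real.exp (b * T) := by ring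
  -- the terms `n ≥ 1`: `|∫ U_{n+2} φ| ≤ ∫ U_{n+1} · 2K(r+4)e^{b min(r+2,T)}`
  set g : ℝ → ℝ := fun r ↦ 2 * K * (r + 4) * Real.exp (b * min (r + 2) T) with hg
  have hgc : Continuous g := by rw [hg]; fun_prop
  have hg0 : ∀ r, 0 ≤ r → 0 ≤ g r := fun r hr ↦ by rw [hg]; positivity
  have hUint : ∀ (n : ℕ) (a c : ℝ), IntervalIntegrable (convPow n) volume a c := fun n a c ↦
    intervalIntegrable_of_abs_le (measurable_convPow n) 1
      (fun s ↦ by rw [abs_of_nonneg (convPow_nonneg n s)]; exact convPow_le_one n s) a c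
  have hterm : ∀ n ∈ Finset.range M,
      1 / ((n + 1 : ℕ) + 1 : ℝ) * |∫ s in (0 : ℝ)..T, convPow (n + 1 + 1) s * φ s| ≤
        ∫ r in (0 : ℝ)..T, convPow (n + 1) r / ((n + 1 : ℕ) + 1) * g r := by
    intro n _
    rw [integral_convPow_succ_mul hφ hΦ le_add_self hT]
    have hn : (0 : ℝ) < (n + 1 : ℕ) + 1 := by positivity
    rw [one_div, inv_mul_le_iff₀ hn]
    have : (∫ r in (0 : ℝ)..T, convPow (n + 1) r / ((n + 1 : ℕ) + 1) * g r) =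
        ((n + 1 : ℕ) + 1 : ℝ)⁻¹ * ∫ r in (0 : ℝ)..T, convPow (n + 1) r * g r := by
      rw [← intervalIntegral.integral_const_mul]
      refine intervalIntegral.integral_congr fun r _ ↦ ?_
      show _ = _; ring
    rw [this, ← mul_assoc, mul_inv_cancel₀ hn.ne', one_mul]
    calc |∫ r in (0 : ℝ)..T, convPow (n + 1) r * (Φ (r + clampT T r) - Φ (r + 1))|
        ≤ ∫ r in (0 : ℝ)..T, |convPow (n + 1) r * (Φ (r + clampT T r) - Φ (r + 1))| :=
          intervalIntegral.abs_integral_le_integral_abs hT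
      _ ≤ ∫ r in (0 : ℝ)..T, convPow (n + 1) r * g r := by
          refine intervalIntegral.integral_mono_on hT ?_ ((hUint _ _ _).mul_continuousOn hgc.continuousOn)
            fun r hr ↦ ?_
          · refine ((hUint (n + 1) 0 T).mul_continuousOn ?_).abs
            have hΦc : Continuous Φ := continuous_iff_continuousAt.mpr fun x ↦ (hΦ x).continuousAt
            refine ((hΦc.comp (continuous_id.add ?_)).sub (hΦc.comp (continuous_id.add continuous_const))).continuousOn
            unfold clampT; fun_prop
          · rw [abs_mul, abs_of_nonneg (convPow_nonneg _ _)]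
            exact mul_le_mul_of_nonneg_left (abs_bracket_le hK hb hΦb hr.1) (convPow_nonneg _ _)
  have hS : ∑ n ∈ Finset.range M, 1 / ((n + 1 : ℕ) + 1 : ℝ) * |∫ s in (0 : ℝ)..T, convPow (n + 1 + 1) s * φ s|
      ≤ ∫ r in (0 : ℝ)..T, (∑ n ∈ Finset.range M, convPow (n + 1) r / ((n + 1 : ℕ) + 1)) * g r := by
    refine (Finset.sum_le_sum hterm).trans (le_of_eq ?_)
    rw [← intervalIntegral.integral_finsetSum]
    · refine intervalIntegral.integral_congr fun r _ ↦ ?_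
      simp only [Finset.sum_mul]
    · intro n _
      exact ((hUint (n + 1) 0 T).div_const _).mul_continuousOn hgc.continuousOn
  have hS2 : ∫ r in (0 : ℝ)..T, (∑ n ∈ Finset.range M, convPow (n + 1) r / ((n + 1 : ℕ) + 1)) * g r
      ≤ ∫ r in (0 : ℝ)..T, 8 * K * Real.exp (b * min (r + 2) T) := by
    have hc8 : Continuous fun r : ℝ ↦ 8 * K * Real.exp (b * min (r + 2) T) := by fun_prop
    have hI : IntervalIntegrable (fun r ↦ (∑ n ∈ Finset.range M, convPow (n + 1) r / ((n + 1 : ℕ) + 1 : ℝ)) * g r)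
        volume 0 T := by
      have h := (IntervalIntegrable.sum (Finset.range M) (μ := volume) (a := 0) (b := T)
        (fun n _ ↦ (hUint (n + 1) 0 T).div_const (((n + 1 : ℕ) : ℝ) + 1))).mul_continuousOn hgc.continuousOn
      convert h using 1
      funext r
      simp only [Finset.sum_apply]
    refine intervalIntegral.integral_mono_on hT hI (hc8.intervalIntegrable _ _) fun r hr ↦ ?_
    have hr0 : 0 ≤ r := hr.1
    have h1 : ∑ n ∈ Finset.range M, convPow (n + 1) r / ((n + 1 : ℕ) + 1 : ℝ) ≤ 2 / (r + 2) := by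
      have h := sum_convPow_div_le (M := M + 1) hr0
      rw [Finset.sum_range_succ'] at h
      simpa using h
    calc (∑ n ∈ Finset.range M, convPow (n + 1) r / ((n + 1 : ℕ) + 1 : ℝ)) * g r ≤ 2 / (r + 2) * g r :=
          mul_le_mul_of_nonneg_right h1 (hg0 r hr0)
      _ = 8 * K * Real.exp (b * min (r + 2) T) * ((r + 4) / (2 * (r + 2))) := by
          rw [hg]; field_simp; ring
      _ ≤ 8 * K * Real.exp (b * min (r + 2) T) * 1 := by
          refine mul_le_mul_of_nonneg_left ?_ (by positivity)
          rw [div_le_one (by positivity)]; linarith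
      _ = _ := mul_one _
  have hS3 : ∫ r in (0 : ℝ)..T, 8 * K * Real.exp (b * min (r + 2) T) ≤ 8 * K * (Real.exp (b * T) * (2 + 1 / b)) := by
    rw [intervalIntegral.integral_const_mul]
    exact mul_le_mul_of_nonneg_left (integral_exp_min_le hb hT) (by positivity)
  have heq : 8 * K * Real.exp (b * T) * (4 + 1 / b) =
      8 * K * (Real.exp (b * T) * (2 + 1 / b)) + 8 * K * Real.exp (b * T) + 8 * K * Real.exp (b * T) := by ring
  rw [heq]
  have h8 : 0 ≤ 8 * K * Real.exp (b * T) := by positivity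
  linarith [hS, hS2, hS3, h0]

end DMV

end Literature.NumberTheory.BeurlingPrimes
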